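import Summits.BirchSwinnertonDyer.BirchSwinnertonDyer.Theorems.ClassRecordThreeSchneiderAtThreeCert
import Summits.BirchSwinnertonDyer.BirchSwinnertonDyer.Theses.KolyvaginRoadThree
import HarnessLib

/-!
# Route `KolyvaginRoadThree` (rung K2@3, third route), crux `SchneiderTamAtThree` (item 19154): the crux AT ONE
# CURVE from ONE certificate row, the class-wide crux from per-curve certificates, and the crux from
# `ClassRecordThree.SchneiderAtThree` — the kernel reading of the REG3CERT tables on the Tamagawa cells
# (cell `bsd-stepL`, seat `bsd-stepL-reg3-eng` g2; `--supports stmt-BirchSwinnertonDyer-19154`)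

HONEST FRAMING: BSD is not proved by any of this; nothing here closes the crux or the rung leaf; the class-wide
statement behind a regulator certificate is Schneider's non-degeneracy conjecture (barrier
`Literature.Barriers.BirchSwinnertonDyer.PAdicHeightNondegeneracy`), asserted NOWHERE below. A certificate row is
EVIDENCE (instrument tier): a per-pair COMPUTED input entering as the hypothesis `RegMult.CertNonsplit W 3 P m`
(`X11b/RegMultCertificateJoin.lean` §3: `m • P` admissible and the Stein–Wuthrich §4.2 height
`heightFourOne W 3 q (m • P) ≠ 0` for THE Tate parameter `q`), never as a fact.

`KolyvaginRoadThree.SchneiderTamAtThree` is `ClassRecordThree.SchneiderAtThree` (item 19106) with one more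
binder `3 ∣ W.tamagawaProduct` (the (T2′)@3 Tamagawa cells: 66 of the 723 TRUE-OPEN non-split (ram) X11b classes
at `3` below `5·10⁵`). This file records (theorems only; 0 definitions, 0 named facts):

* `schneiderTamAtThree_at_of_certNonsplit` — the MATRIX of the crux at ONE curve `W`, from GZK (`hGZK`) and ONE
  non-split certificate `RegMult.CertNonsplit W 3 P m` (the extra Tamagawa binder is not used): the companion of
  `RegMult.schneiderAtThree_at_of_certNonsplit` (p419044). Every one of the 723 rows of REG3CERT/v1 (kit j249075,
  evidence on items 19106/19154; cell file `run/shared/lean/pub/bsd-stepL/reg3/REG3CERT-TABLE.md`) instantiates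
  `hc` for its curve — in particular the 66 Tamagawa classes — EVIDENCE, per pair.
* `schneiderTamAtThree_of_forall_certNonsplit` — the crux BY NAME from GZK and a certificate FOR EVERY curve of
  its locus (the honest class-wide reading of a certificate table; the `∀` is Schneider's conjecture on this locus
  and is NOT supplied by any finite table).
* `schneiderTamAtThree_of_schneiderAtThree` — the crux BY NAME from `ClassRecordThree.SchneiderAtThree` (drop the
  Tamagawa binder): the route file's "implied by it (one-line proof)" in the tree, so that whatever closes item
  19106 closes item 19154 by this term.

References: [SteinWuthrich2013] §4.2 (p. 15), Conj. 4.1; [Schneider1982PadicHeightI] §1;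
[KolyvaginEulerSystems1990] Thm. A (GZK); cell files `X11b/RegMultCertificateJoin.lean`,
`Theorems/ClassRecordThreeSchneiderAtThreeCert.lean` (p419044).
-/

open scoped Classical

open WeierstrassCurve Literature.NumberTheory.EllipticCurves
  Literature.NumberTheory.EllipticCurves.Rank1Residual
  Summit.BirchSwinnertonDyer.Rank1Residual
  Summit.BirchSwinnertonDyer.Rank1Residual.X11b

namespace Summit.BirchSwinnertonDyer.Rank1Residual.X11b.RegMult

/-- **`SchneiderTamAtThree` at ONE curve from ONE certificate row.** For `W` globally minimal in class X11b at
`3`, GZK gives Mordell–Weil rank one; a non-split certificate row `RegMult.CertNonsplit W 3 P m` then yields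
`ClassClosure.RegulatorNonvanishingAt W 3` (`RegMult.regulatorNonvanishingAt_of_cert_of_not_split`; the split
clause is vacuous at a non-split prime). The `Ram W 3` and `3 ∣ W.tamagawaProduct` binders of the crux are not
used. Per pair; EVIDENCE-fed; nothing class-wide is asserted.
[cite: SteinWuthrich2013, §4.2 (p. 15) and Conj. 4.1] [cite: KolyvaginEulerSystems1990, Thm. A] -/
theorem schneiderTamAtThree_at_of_certNonsplit (hGZK : rank_eq_analyticRank_of_analyticRank_le_one)
    (W : WeierstrassCurve ℚ) [W.IsElliptic] [W.IsGloballyMinimal] {P : W.toAffine.Point} {m : ℕ}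
    (hc : RegMult.CertNonsplit W 3 P m) :
    ClassX11b W 3 → Ram W 3 → ¬ W.HasSplitMultiplicativeReductionAtPrime 3 → 3 ∣ W.tamagawaProduct →
      ClassClosure.RegulatorNonvanishingAt W 3 :=
  fun hX hram hns _ => schneiderAtThree_at_of_certNonsplit hGZK W hc hX hram hns

/-- **The crux `SchneiderTamAtThree` BY NAME from GZK and a non-split certificate for EVERY curve of its
locus** (class X11b at `3`, a (ram) prime, non-split reduction at `3`, `3 ∣ ∏ c_ℓ`). The hypothesis quantifies
over the whole (infinite) locus — it IS Schneider's non-degeneracy there in certificate currency; a finite table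
(REG3CERT/v1: 66/66 Tamagawa classes among 723/723 below `5·10⁵`) instantiates it row by row and never
discharges the `∀`. [cite: SteinWuthrich2013, §4.2 and Conj. 4.1] [cite: Schneider1982PadicHeightI, §1] -/
theorem schneiderTamAtThree_of_forall_certNonsplit (hGZK : rank_eq_analyticRank_of_analyticRank_le_one)
    (hc : ∀ (W : WeierstrassCurve ℚ) [W.IsElliptic] [W.IsGloballyMinimal],
      ClassX11b W 3 → Ram W 3 → ¬ W.HasSplitMultiplicativeReductionAtPrime 3 → 3 ∣ W.tamagawaProduct →
        ∃ (P : W.toAffine.Point) (m : ℕ), RegMult.CertNonsplit W 3 P m) :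
    Summit.BirchSwinnertonDyer.BirchSwinnertonDyer.Theses.KolyvaginRoadThree.SchneiderTamAtThree := by
  intro W _ _ hX hram hns htam
  obtain ⟨P, m, hPm⟩ := hc W hX hram hns htam
  exact schneiderTamAtThree_at_of_certNonsplit hGZK W hPm hX hram hns htam

/-- **`SchneiderTamAtThree` from `ClassRecordThree.SchneiderAtThree`** (item 19154 from item 19106): the
Kolyvagin road's regulator crux is the class-record one restricted to the Tamagawa cells, so it follows by
dropping the binder `3 ∣ W.tamagawaProduct`. Unconditional glue; nothing asserted. [folklore] -/
theorem schneiderTamAtThree_of_schneiderAtThree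
    (h : Summit.BirchSwinnertonDyer.BirchSwinnertonDyer.Theses.ClassRecordThree.SchneiderAtThree) :
    Summit.BirchSwinnertonDyer.BirchSwinnertonDyer.Theses.KolyvaginRoadThree.SchneiderTamAtThree :=
  fun W _ _ hX hram hns _ => h W hX hram hns

end Summit.BirchSwinnertonDyer.Rank1Residual.X11b.RegMult
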